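import Summits.NavierStokesRegularity.FluidComputer.CollapseAnsatzVorticityObstruction
import Mathlib.Analysis.SpecialFunctions.JapaneseBracket
import HarnessLib

/-!
# No exact collapse design in the CIV far-field class, for any `0 < γ < 2/3`, `γ ≠ ½`, and any pressure

Cell `ns-blowup`, seat `ns-blowup-ecbridge-2` (g4; the E–C endpoint theory seat). LABEL: E–C typing
(KERNEL, FACT-FREE; theorems only). WHAT THIS IS NOT: not Navier–Stokes evidence — a necessary
condition on a DESIGN. Part 3 of the collapse-ansatz obstruction
(`CollapseAnsatzResidualCurl`, `CollapseAnsatzVorticityObstruction`), read on the regularity cell's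
own profile class `HasSelfSimilarFarFieldWith γ c C U` (`SelfSimilarEulerProfile.lean`; Constantin–
Ignatova–Vicol 2026, (3.8): `|U(y)| ≤ C|y−c|⟨y−c⟩^{−1/γ}`, `|curl U(y)| + |DU(y)| ≤ C⟨y−c⟩^{−1/γ}`).

## Content

* `norm_le_of_farField` — a far-field profile with `0 < γ ≤ 1` is BOUNDED (by `C`);
* `memLp_two_curl_of_farField` — its vorticity is in `L²(ℝ³)` as soon as `γ < 2/3`
  (`⟨y⟩^{−2/γ}` integrable in dimension `3`; Mathlib `integrable_rpow_neg_one_add_norm_sq`);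
* **`farField_profile_eq_zero[_local]`** — hence, by part 2 (`profile_const` + `U(c) = 0`): for
  `0 < γ < 2/3`, `γ ≠ ½`, `ν ≠ 0`, a divergence-free `C³` profile of the far-field class whose EXACT
  collapse ansatz has a residual with bounded curl (ANY `C²` pressures; globally, or on a ball around
  the singular point) is IDENTICALLY ZERO;
* **`farField_profile_eq_zero_of_clayResidual[_local]`** — in particular no nonzero profile of the
  class, used as an exact ansatz with any pressure, has a Clay-class residual: the exact collapse
  ansatz on the CIV class is never an E–C design (the whole Euler window `2/5 ≤ γ < ½` and beyond).

References: P. Constantin, M. Ignatova, V. Vicol, arXiv:2602.17570 (2026), §3.1.3 (3.8)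
[cite: ConstantinIgnatovaVicol2026Putative, §3.1.3 eq. (3.8)]; C. L. Fefferman, Clay problem
description, (C), (5) [cite: FeffermanClay2006, (5)].
-/

noncomputable section

namespace Summit.NavierStokesRegularity.FluidComputer.CollapseAnsatz

open Set Filter Topology Function InnerProductSpace MeasureTheory
open scoped Laplacian RealInnerProductSpace ENNReal
open Literature.Analysis.FluidPDE

variable {γ T ν t₁ C : ℝ} {c : EuclideanSpace ℝ (Fin 3)}
  {U : EuclideanSpace ℝ (Fin 3) → EuclideanSpace ℝ (Fin 3)} {q : ℝ → EuclideanSpace ℝ (Fin 3) → ℝ}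

/-! ## §1 The far-field class: bounded velocity, square-integrable vorticity -/

/-- **A far-field profile with `0 < γ ≤ 1` is bounded**: `‖U(y)‖ ≤ C ⟨y−c⟩^{1−1/γ} ≤ C`
(`1 − 1/γ ≤ 0`). [cite: ConstantinIgnatovaVicol2026Putative, §3.1.3 eq. (3.8)] -/
theorem norm_le_of_farField (h : HasSelfSimilarFarFieldWith γ c C U) (hγ0 : 0 < γ) (hγ1 : γ ≤ 1)
    (y : EuclideanSpace ℝ (Fin 3)) : ‖U y‖ ≤ C := by
  have hC : 0 ≤ C := h.nonneg
  have hexp : (1 - 1 / γ) / 2 ≤ 0 := by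
    have : 1 ≤ 1 / γ := by rw [le_div_iff₀ hγ0]; linarith
    linarith
  have hb : 1 ≤ 1 + ‖y - c‖ ^ 2 := by nlinarith [sq_nonneg ‖y - c‖]
  calc ‖U y‖ ≤ C * (1 + ‖y - c‖ ^ 2) ^ ((1 - 1 / γ) / 2) := h.norm_le_rpow y
    _ ≤ C * 1 := mul_le_mul_of_nonneg_left (Real.rpow_le_one_of_one_le_of_nonpos hb hexp) hC
    _ = C := mul_one C

/-- **The vorticity of a far-field profile with `0 < γ < 2/3` is in `L²(ℝ³)`**:
`‖curl U(y)‖² ≤ C² ⟨y−c⟩^{−2/γ}` and `2/γ > 3`. [cite: ConstantinIgnatovaVicol2026Putative, §3.1.3 eq. (3.8)] -/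
theorem memLp_two_curl_of_farField (h : HasSelfSimilarFarFieldWith γ c C U) (hγ0 : 0 < γ)
    (hγ1 : γ < 2 / 3) (hU : ContDiff ℝ 1 U) : MemLp (curl U) 2 volume := by
  have hC : 0 ≤ C := h.nonneg
  have hmeas : AEStronglyMeasurable (curl U) volume := (continuous_curl hU).aestronglyMeasurable
  rw [memLp_two_iff_integrable_sq_norm hmeas]
  -- the dominating function `C² ⟨y − c⟩^{−2/γ}`
  have hr : (Module.finrank ℝ (EuclideanSpace ℝ (Fin 3)) : ℝ) < 2 / γ := by
    rw [finrank_euclideanSpace_fin, Nat.cast_ofNat, lt_div_iff₀ hγ0]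
    linarith
  have hint : Integrable (fun y : EuclideanSpace ℝ (Fin 3) =>
      C ^ 2 * ((1 : ℝ) + ‖y - c‖ ^ 2) ^ (-(2 / γ) / 2)) volume :=
    ((integrable_rpow_neg_one_add_norm_sq hr).comp_sub_right c).const_mul (C ^ 2)
  refine hint.mono' (hmeas.norm.pow 2) (Eventually.of_forall fun y => ?_)
  have hb : 0 < 1 + ‖y - c‖ ^ 2 := by positivity
  have h1 : ‖curl U y‖ ≤ C * (1 + ‖y - c‖ ^ 2) ^ (-(1 / (2 * γ))) := h.norm_curl_le y
  have h0 : 0 ≤ ‖curl U y‖ := norm_nonneg _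
  rw [Real.norm_eq_abs, abs_of_nonneg (sq_nonneg _)]
  calc ‖curl U y‖ ^ 2 ≤ (C * (1 + ‖y - c‖ ^ 2) ^ (-(1 / (2 * γ)))) ^ 2 :=
        pow_le_pow_left₀ h0 h1 2
    _ = C ^ 2 * ((1 + ‖y - c‖ ^ 2) ^ (-(2 / γ) / 2)) := by
        rw [mul_pow, ← Real.rpow_natCast ((1 + ‖y - c‖ ^ 2) ^ (-(1 / (2 * γ)))) 2,
          ← Real.rpow_mul hb.le]
        congr 2
        push_cast
        ring

/-! ## §2 The exact collapse ansatz on the far-field class is trivial -/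

/-- **No exact collapse design in the CIV far-field class (global curl bound).** Let `0 < γ < 2/3`,
`γ ≠ ½`, `ν ≠ 0`, and let `U ∈ C³` be divergence free and of the far-field class
`HasSelfSimilarFarFieldWith γ c C U`. If the residual `∂ₜu + (u·∇)u − νΔu + ∇q(t)` of the EXACT
ansatz `u = selfSimilarCollapse γ T U`, with ANY `C²` pressures `q(t)`, has bounded curl on
`(t₁, T) × ℝ³`, then `U ≡ 0` (part 2: `curl U ∈ L²` ⇒ irrotational ⇒ constant (bounded, div-free) ⇒
`= U(c) = 0`). No named fact. [cite: ConstantinIgnatovaVicol2026Putative, §3.1.3 eq. (3.8)] -/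
theorem farField_profile_eq_zero (hγ0 : 0 < γ) (hγ : γ ≠ 1 / 2) (hγ1 : γ < 2 / 3) (hν : ν ≠ 0)
    (ht₁ : t₁ < T) (hU : ContDiff ℝ 3 U) (hdiv : VectorCalculus.IsDivFree U)
    (hfar : HasSelfSimilarFarFieldWith γ c C U) (hq : ∀ t ∈ Ioo t₁ T, ContDiff ℝ 2 (q t)) {M : ℝ}
    (hbd : ∀ t ∈ Ioo t₁ T, ∀ x,
      ‖curl (fun z => timeDeriv (selfSimilarCollapse γ T U) t z +
          convect (selfSimilarCollapse γ T U t) (selfSimilarCollapse γ T U t) z -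
          ν • (Δ (selfSimilarCollapse γ T U t)) z + gradient (q t) z) x‖ ≤ M) : U = 0 := by
  have hω := memLp_two_curl_of_farField hfar hγ0 hγ1 (hU.of_le (by norm_cast))
  have hconst := profile_const hγ (by linarith) hν ht₁ hU hdiv hq hbd (p := 2) (by norm_num)
    ENNReal.ofNat_ne_top hω (norm_le_of_farField hfar hγ0 (by linarith))
  funext y
  rw [hconst y c, hfar.apply_center]
  rfl

/-- **No exact collapse design in the CIV far-field class (local curl bound, cut-off designs).**
Same conclusion when the curl of the residual is only bounded on `(t₁, T) × B(0, ρ)`, `ρ > 0`.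
No named fact. [cite: ConstantinIgnatovaVicol2026Putative, §3.1.3 eq. (3.8)] -/
theorem farField_profile_eq_zero_local (hγ0 : 0 < γ) (hγ : γ ≠ 1 / 2) (hγ1 : γ < 2 / 3) (hν : ν ≠ 0)
    (ht₁ : t₁ < T) (hU : ContDiff ℝ 3 U) (hdiv : VectorCalculus.IsDivFree U)
    (hfar : HasSelfSimilarFarFieldWith γ c C U) (hq : ∀ t ∈ Ioo t₁ T, ContDiff ℝ 2 (q t)) {M ρ : ℝ}
    (hρ : 0 < ρ)
    (hbd : ∀ t ∈ Ioo t₁ T, ∀ x ∈ Metric.ball (0 : EuclideanSpace ℝ (Fin 3)) ρ,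
      ‖curl (fun z => timeDeriv (selfSimilarCollapse γ T U) t z +
          convect (selfSimilarCollapse γ T U t) (selfSimilarCollapse γ T U t) z -
          ν • (Δ (selfSimilarCollapse γ T U t)) z + gradient (q t) z) x‖ ≤ M) : U = 0 := by
  have hω := memLp_two_curl_of_farField hfar hγ0 hγ1 (hU.of_le (by norm_cast))
  have hU2 : ContDiff ℝ 2 U := hU.of_le (by norm_cast)
  have hcurl0 : ∀ y, curl U y = 0 := by
    have hω2 : ContDiff ℝ 2 (curl U) := contDiff_curl (n := 2) (by exact_mod_cast hU)
    have hΔω : ∀ y, (Δ (curl U)) y = 0 := fun y => by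
      rw [← curl_laplacian hU y]
      exact (curl_laplacian_profile_eq_zero_local hγ hγ0 hν ht₁ hU hq hρ hbd).1 y
    have hh := eq_zero_of_harmonic_memLp_inner (harmonicOnNhd_of_laplacian_eq_zero hω2 hΔω)
      (q := 2) (by norm_num) ENNReal.ofNat_ne_top hω
    exact fun y => congrFun hh y
  have hconst := eq_of_curl_eq_zero_of_isDivFree_of_bounded hU2 hcurl0 hdiv
    (norm_le_of_farField hfar hγ0 (by linarith))
  funext y
  rw [hconst y c, hfar.apply_center]
  rfl

/-! ## §3 The E–C reading on the far-field class -/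

/-- **No nonzero far-field profile is an exact E–C collapse design (global).** For `0 < γ < 2/3`,
`γ ≠ ½`, `ν ≠ 0`: if a Clay-class force `F` agrees on `(t₁, T) × ℝ³` (`0 ≤ t₁ < T`) with the
residual of the exact ansatz on a divergence-free `C³` profile of the class
`HasSelfSimilarFarFieldWith γ c C U`, with ANY `C²` pressures, then `U ≡ 0`. No named fact.
[cite: FeffermanClay2006, (C) (5)] [cite: ConstantinIgnatovaVicol2026Putative, §3.1.3 eq. (3.8)] -/
theorem farField_profile_eq_zero_of_clayResidual (hγ0 : 0 < γ) (hγ : γ ≠ 1 / 2) (hγ1 : γ < 2 / 3)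
    (hν : ν ≠ 0) (ht₁0 : 0 ≤ t₁) (ht₁ : t₁ < T) (hU : ContDiff ℝ 3 U)
    (hdiv : VectorCalculus.IsDivFree U) (hfar : HasSelfSimilarFarFieldWith γ c C U)
    (hq : ∀ t ∈ Ioo t₁ T, ContDiff ℝ 2 (q t))
    {F : ℝ → EuclideanSpace ℝ (Fin 3) → EuclideanSpace ℝ (Fin 3)}
    (hFs : IsSmoothOnHalfSpace F) (hFd : HasRapidSpaceTimeDecay F)
    (hres : ∀ t ∈ Ioo t₁ T, ∀ x, F t x =
      timeDeriv (selfSimilarCollapse γ T U) t x +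
        convect (selfSimilarCollapse γ T U t) (selfSimilarCollapse γ T U t) x -
        ν • (Δ (selfSimilarCollapse γ T U t)) x + gradient (q t) x) : U = 0 := by
  obtain ⟨M, hM⟩ := clayForce_curl_bounded hFs hFd
  refine farField_profile_eq_zero hγ0 hγ hγ1 hν ht₁ hU hdiv hfar hq (M := M) fun t ht x => ?_
  have hfun : (fun z => timeDeriv (selfSimilarCollapse γ T U) t z +
      convect (selfSimilarCollapse γ T U t) (selfSimilarCollapse γ T U t) z -
      ν • (Δ (selfSimilarCollapse γ T U t)) z + gradient (q t) z) = F t :=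
    funext fun z => (hres t ht z).symm
  rw [hfun]
  exact hM t (ht₁0.trans ht.1.le) x

/-- **No nonzero far-field profile is an exact E–C collapse design (local, cut-off designs).** The
same when the Clay force agrees with the residual only on `(t₁, T) × B(0, ρ)`. No named fact.
[cite: FeffermanClay2006, (C) (5)] [cite: ConstantinIgnatovaVicol2026Putative, §3.1.3 eq. (3.8)] -/
theorem farField_profile_eq_zero_of_clayResidual_local (hγ0 : 0 < γ) (hγ : γ ≠ 1 / 2)
    (hγ1 : γ < 2 / 3) (hν : ν ≠ 0) (ht₁0 : 0 ≤ t₁) (ht₁ : t₁ < T) (hU : ContDiff ℝ 3 U)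
    (hdiv : VectorCalculus.IsDivFree U) (hfar : HasSelfSimilarFarFieldWith γ c C U)
    (hq : ∀ t ∈ Ioo t₁ T, ContDiff ℝ 2 (q t)) {ρ : ℝ} (hρ : 0 < ρ)
    {F : ℝ → EuclideanSpace ℝ (Fin 3) → EuclideanSpace ℝ (Fin 3)}
    (hFs : IsSmoothOnHalfSpace F) (hFd : HasRapidSpaceTimeDecay F)
    (hres : ∀ t ∈ Ioo t₁ T, ∀ x ∈ Metric.ball (0 : EuclideanSpace ℝ (Fin 3)) ρ, F t x =
      timeDeriv (selfSimilarCollapse γ T U) t x +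
        convect (selfSimilarCollapse γ T U t) (selfSimilarCollapse γ T U t) x -
        ν • (Δ (selfSimilarCollapse γ T U t)) x + gradient (q t) x) : U = 0 := by
  obtain ⟨M, hM⟩ := clayForce_curl_bounded hFs hFd
  refine farField_profile_eq_zero_local hγ0 hγ hγ1 hν ht₁ hU hdiv hfar hq (M := M) hρ
    fun t ht x hx => ?_
  have hnhds : (fun z => timeDeriv (selfSimilarCollapse γ T U) t z +
      convect (selfSimilarCollapse γ T U t) (selfSimilarCollapse γ T U t) z -
      ν • (Δ (selfSimilarCollapse γ T U t)) z + gradient (q t) z) =ᶠ[𝓝 x] F t := by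
    filter_upwards [Metric.isOpen_ball.mem_nhds hx] with z hz
    exact (hres t ht z hz).symm
  rw [curl_eq_curlCLM, hnhds.fderiv_eq, ← curl_eq_curlCLM]
  exact hM t (ht₁0.trans ht.1.le) x

end Summit.NavierStokesRegularity.FluidComputer.CollapseAnsatz

end
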